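import Literature.MathematicalPhysics.QuantumFieldTheory.Balaban1983to89.B1Eq324BenfattoCondCentre
import HarnessLib

/-!
# `Balaban1983to89.B1Eq324BenfattoAppendixC2` — [BenfattoEtAl1978] Appendix C point 1) p. 164: the free covariance of the field
# (1.1) is non-negative, DECAYS like `(1 + α²/2d)^{−d(Δ,Δ′)}` (C.2), is dominated by its diagonal (C.4) and has TOTAL MASS
# `1/(α²β)` (C.5) — PROVED for the tree's `freeCov d α β`

statement-level skeleton of published theorems with citation tags; proofs where landed; nothing here is a claim about the
Yang–Mills mass gap

WHY THIS MODULE (cell `pub-ymgap`, seat `dag-n08-b`, node N08 «first missing estimate» lane; sequel of `B1Eq324BenfattoAppendixA` /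
`…AppendixC` / `…CondCentre` / `…AppendixCLemma2`).  With App. A and App. C Lemmas 1–2 in the tree, the remaining printed inputs of
§5 (pp. 153–159, the cluster expansion proving the p. 152 Basic Lemma `B1Eq324BenfattoLemma.BasicLemmaPrinted` behind
[Balaban1982Higgs1] (3.24) / [Balaban1985UV3] (24), (58)) that are one-module-sized are the «well-known [7]» properties (C.2)–(C.5)
of the free covariance, used throughout §5 (the decay `‖c‖e^{−ϰ′d(Δ,Δ′)}`) and in App. D (`‖C‖` of Lemma 1).

THE PRINTED TEXT (p. 164, verbatim from the page images, lit-balaban desk ME #23): *"1) The covariance C_{Δ,Δ′} is such that, if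
ξ_Δ is the center of Δ:* `0 ≦ C_{ΔΔ′} = (2π)^{−d} ∫_{−π}^{π} e^{ik(ξ_Δ−ξ_{Δ′})} dk / (α²β + 2β Σ_{i=1}^{d} (1 − cos k_i))
≦ (1/(βα²)) (1 + α²/(2d))^{−d(Δ,Δ′)} ≡ ‖c‖ e^{−ϰ′ d(Δ,Δ′)}` *(C.2). If π_n(Δ,Δ′) is the number of walks on the lattice of the
centers of the tesserae divided by (2d)ⁿ:* `C_{ΔΔ′} = (1/(β(α²+2d))) Σ_{n=0}^{∞} (2d/(2d+α²))ⁿ π_n(Δ,Δ′)` *(C.3),*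
`0 ≦ C_{ΔΔ′} < 1/2` *(C.4),* `‖C‖ ≡ Σ_{Δ′} C_{ΔΔ′} = 1/(α²β)` *(C.5)."*

DICTIONARY.  `C_{ΔΔ′}` ↦ `freeCov d α β x y = β⁻¹C¹_{α²}(x − y)` (`B1Eq324BenfattoLemma`; the momentum integral of (C.2) IS the
tree's `CetaM_eq_integral` up to the factor `β⁻¹`); `d(Δ,Δ′)` ↦ `cubeDist x y` (p. 146); the walk-length that drives the proof
here is the `ℓ¹` distance `Σ_j |x_j − y_j|` of the centres, which dominates `cubeDist`.

WHAT IS PROVED (no definition, no named fact, no `sorry`; axioms standard).  Route for (C.2): NOT the walk expansion (C.3) but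
the massive maximum principle of `B1Eq324BenfattoCondCentre` (private copy `le_of_subsolution'`): `x ↦ K(x, c)` is bounded,
`(−Δ + α²)`-harmonic off `c` (`freeCov_lattice_eq`), and `ρ^{|x − c|₁}`, `ρ = 2d/(2d + α²) = (1 + α²/2d)⁻¹`, is a supersolution off
`c` agreeing with `K(c,c)·ρ⁰` at `c`.
* `freeCov_nonneg` ((C.2)/(C.4) left: `0 ≦ C_{ΔΔ′}`, r15's `Cxi_nonneg`);
* `freeCov_le_self_mul_pow_l1` (`K(x, y) ≤ K(0,0)·ρ^{|x−y|₁}`), `freeCov_le_diag` ((C.4)-type: `C_{ΔΔ′} ≦ C_{ΔΔ} = E z_Δ²`; print's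
  strict `< ½` at the normalisation `E z² = ½` is not claimed), **`freeCov_le_decay`** = (C.2) AS PRINTED for `d ≥ 1`:
  `C_{ΔΔ′} ≦ (1/(βα²))(1 + α²/(2d))^{−d(Δ,Δ′)}` (real power; `cubeDist ≤ ℓ¹`, `K(0,0) ≤ 1/(βα²)` by `abs_freeCov_le`);
* **`tsum_freeCov`** = (C.5): `Σ_{Δ′} C_{ΔΔ′} = 1/(α²β)` (r15's unit mass `B3CxiPropagator.tsum_Cxi`, reindexed), with
  `summable_freeCov`.
* **`posDef_covGram_freeCov`** / **`isUnit_det_covGram_freeCov`** — the Gram matrices `K_ΓΓ` are positive DEFINITE (strictly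
  positive weight in (C.2) + orthogonality of the characters on the Brillouin box, `B3CxiPropagator.integral_bzBox_cos_phase`): the
  referee condition (c1) on `B1Eq324BenfattoCondCentre` — the regression dictionary `condMean`/`condCov`/`condField` is print's
  conditioning (C.7) exactly, never Mathlib's singular-inverse branch.

* **`condCov_freeCov_nonneg_le`** = (C.6) ENTRYWISE, `0 ≦ C^Γ_{ΔΔ′} ≦ C_{ΔΔ′}` (both by the maximum principle applied to the
  regression of the column `K(·, Δ′)`; `condCov_eq_sub_condMean`).

NOT HERE: the walk expansion (C.3) itself; the strict `< ½` of (C.4); the centre FORMULA (C.7) as an identity (the tree's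
`condMean` is characterised instead by `B1Eq324BenfattoCondCentre.condMean_apply_of_mem` + `condMean_freeCov_harmonic`).
NOT summit progress; count-neutral for N08.
-/

noncomputable section

open Finset MeasureTheory
open scoped BigOperators Matrix

namespace Literature.MathematicalPhysics.QuantumFieldTheory.Balaban1983to89.B1Eq324BenfattoAppendixC2

open Literature.MathematicalPhysics.QuantumFieldTheory
open Literature.MathematicalPhysics.QuantumFieldTheory.Balaban1983to89.B3Sect3VectorSelfEnergy
open Literature.MathematicalPhysics.QuantumFieldTheory.Balaban1983to89.B3CxiPropagator
open Literature.MathematicalPhysics.QuantumFieldTheory.Balaban1983to89.B3WT226FreeLattice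
open Literature.MathematicalPhysics.QuantumFieldTheory.Balaban1983to89.B1Eq324BenfattoLemma
open Literature.MathematicalPhysics.QuantumFieldTheory.Balaban1983to89.B1Eq324BenfattoAppendixA
open Literature.MathematicalPhysics.QuantumFieldTheory.Balaban1983to89.B1Eq324BenfattoCondCentre

variable {d : ℕ}

/-! ## (C.2), left: non-negativity -/

/-- **`0 ≦ C_{ΔΔ′}`** — the free covariance is entrywise non-negative (ferromagnetic Gaussian field; r15's `Cxi_nonneg` for the
momentum integral). [cite: BenfattoEtAl1978, Appendix C (C.2) p.164] -/
theorem freeCov_nonneg {α β : ℝ} (hα : 0 < α) (hβ : 0 < β) (x y : B1Eq324BenfattoLemma.Site d) : 0 ≤ freeCov d α β x y := by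
  simp only [freeCov]
  exact mul_nonneg (inv_pos.2 hβ).le (CetaM_nonneg one_pos (pow_pos hα 2) _)

/-! ## (C.2), right: exponential decay by the maximum principle -/

/-- Maximum principle for bounded subsolutions of `(2d + κ)w ≤ Σ_{x′∼x} w(x′)` off a finite set, `κ > 0` (private copy of
`B1Eq324BenfattoCondCentre`'s). [folklore] -/
private theorem le_of_subsolution' {κ B : ℝ} (hκ : 0 < κ) (Γ : Finset (B1Eq324BenfattoLemma.Site d))
    {w : B1Eq324BenfattoLemma.Site d → ℝ} (hB : ∀ x, w x ≤ B) (hΓ : ∀ x ∈ Γ, w x ≤ 0)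
    (hsub : ∀ x ∉ Γ, (2 * d + κ) * w x ≤ ∑ μ : Fin d, (w (x + unitVec μ) + w (x - unitVec μ))) :
    ∀ x, w x ≤ 0 := by
  have hbdd : BddAbove (Set.range w) := ⟨B, by rintro _ ⟨x, rfl⟩; exact hB x⟩
  set S : ℝ := ⨆ x, w x with hS
  have hwS : ∀ x, w x ≤ S := fun x => le_ciSup hbdd x
  by_contra hcon
  push Not at hcon
  obtain ⟨x₀, hx₀⟩ := hcon
  have hSpos : 0 < S := hx₀.trans_le (hwS x₀)
  have hθ : 2 * d / (2 * d + κ) * S < S := by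
    rw [div_mul_eq_mul_div, div_lt_iff₀ (by positivity)]
    nlinarith
  obtain ⟨x₁, hx₁⟩ : ∃ x₁, 2 * d / (2 * d + κ) * S < w x₁ := exists_lt_of_lt_ciSup hθ
  have hx₁Γ : x₁ ∉ Γ := by
    intro h
    have := hΓ x₁ h
    have : 0 ≤ 2 * d / (2 * d + κ) * S := by positivity
    linarith
  have hnb : ∑ μ : Fin d, (w (x₁ + unitVec μ) + w (x₁ - unitVec μ)) ≤ 2 * d * S := by
    calc ∑ μ : Fin d, (w (x₁ + unitVec μ) + w (x₁ - unitVec μ)) ≤ ∑ _μ : Fin d, (S + S) :=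
          Finset.sum_le_sum fun μ _ => add_le_add (hwS _) (hwS _)
      _ = 2 * d * S := by
          rw [Finset.sum_const, Finset.card_univ, Fintype.card_fin, nsmul_eq_mul]
          ring
  have h3 := (hsub x₁ hx₁Γ).trans hnb
  have h4 : w x₁ ≤ 2 * d / (2 * d + κ) * S := by
    rw [div_mul_eq_mul_div, le_div_iff₀ (by positivity)]
    linarith
  linarith

/-- The `ℓ¹` length drops by at most one under a unit step: `|x − c|₁ − 1 ≤ |x + σe_μ − c|₁` (`σ = ±1`). [folklore] -/
private theorem l1_sub_one_le_step (x c : B1Eq324BenfattoLemma.Site d) (μ : Fin d) {σ : ℤ} (hσ : σ = 1 ∨ σ = -1) :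
    ∑ j, (x j - c j).natAbs - 1 ≤ ∑ j, ((x + σ • unitVec μ) j - c j).natAbs := by
  have hμ : ((x + σ • unitVec μ) μ - c μ) = (x μ - c μ) + σ := by
    simp only [Pi.add_apply, Pi.smul_apply, unitVec, Pi.single_eq_same, smul_eq_mul, mul_one]
    ring
  have hoff : ∀ j, j ≠ μ → ((x + σ • unitVec μ) j - c j) = x j - c j := by
    intro j hj
    simp only [Pi.add_apply, Pi.smul_apply, unitVec, Pi.single_apply, if_neg hj, smul_zero, add_zero]
  have hstep : (x μ - c μ).natAbs ≤ ((x + σ • unitVec μ) μ - c μ).natAbs + 1 := by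
    rw [hμ]
    rcases hσ with h | h <;> subst h <;> omega
  rw [← Finset.add_sum_erase _ _ (Finset.mem_univ μ), ← Finset.add_sum_erase _ _ (Finset.mem_univ μ)]
  have hrest : ∑ j ∈ Finset.univ.erase μ, ((x + σ • unitVec μ) j - c j).natAbs =
      ∑ j ∈ Finset.univ.erase μ, (x j - c j).natAbs :=
    Finset.sum_congr rfl fun j hj => by rw [hoff j (Finset.ne_of_mem_erase hj)]
  rw [hrest]
  omega

/-- **Pointwise decay in the `ℓ¹` distance**: `K(x, c) ≤ K(0,0)·ρ^{|x − c|₁}`, `ρ = 2d/(2d + α²)` — the profile `ρ^{|·−c|₁}` is a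
supersolution of `(−Δ + α²)` off `c` and `K(·, c)` a bounded solution equal to `K(0,0)` at `c`.
[cite: BenfattoEtAl1978, Appendix C (C.2) p.164] -/
theorem freeCov_le_self_mul_pow_l1 {α β : ℝ} (hα : 0 < α) (hβ : 0 < β) (x c : B1Eq324BenfattoLemma.Site d) :
    freeCov d α β x c ≤ freeCov d α β 0 0 * (2 * d / (2 * d + α ^ 2)) ^ (∑ j, (x j - c j).natAbs) := by
  set K := freeCov d α β with hK
  set ρ : ℝ := 2 * d / (2 * d + α ^ 2) with hρ
  have hα2 : 0 < α ^ 2 := by positivity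
  have hρ0 : 0 ≤ ρ := by positivity
  have hρ1 : ρ ≤ 1 := by
    rw [hρ, div_le_one (by positivity)]
    linarith
  have hρkey : (2 * d + α ^ 2) * ρ = 2 * d := by
    rw [hρ]
    field_simp
  have hK00 : 0 ≤ K 0 0 := freeCov_nonneg hα hβ 0 0
  set n : B1Eq324BenfattoLemma.Site d → ℕ := fun y => ∑ j, (y j - c j).natAbs with hn
  set w : B1Eq324BenfattoLemma.Site d → ℝ := fun y => K y c - K 0 0 * ρ ^ n y with hw
  -- boundedness and the value at `c`
  have hB : ∀ y, w y ≤ β⁻¹ * (α ^ 2)⁻¹ := fun y => by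
    have h1 := (abs_le.1 (abs_freeCov_le hα hβ y c)).2
    have h2 : 0 ≤ K 0 0 * ρ ^ n y := mul_nonneg hK00 (pow_nonneg hρ0 _)
    simp only [hw]
    linarith
  have hΓ : ∀ y ∈ ({c} : Finset (B1Eq324BenfattoLemma.Site d)), w y ≤ 0 := by
    intro y hy
    rw [Finset.mem_singleton] at hy
    subst hy
    have hn0 : n y = 0 := by simp [hn]
    simp only [hw, hn0, pow_zero, mul_one, freeCov_self α β y, sub_self, le_refl, hK]
  -- the subsolution inequality off `c`
  have hsub : ∀ y ∉ ({c} : Finset (B1Eq324BenfattoLemma.Site d)),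
      (2 * d + α ^ 2) * w y ≤ ∑ μ : Fin d, (w (y + unitVec μ) + w (y - unitVec μ)) := by
    intro y hy
    rw [Finset.mem_singleton] at hy
    have hharm := freeCov_lattice_eq (d := d) β hα y c
    rw [if_neg hy, sub_eq_zero] at hharm
    -- `n y ≥ 1` off `c`
    have hn1 : 1 ≤ n y := by
      by_contra h0
      push Not at h0
      have hzero : ∀ j, (y j - c j).natAbs = 0 := fun j =>
        Nat.eq_zero_of_le_zero ((Finset.single_le_sum (fun j _ => Nat.zero_le _) (Finset.mem_univ j)).trans
          (Nat.lt_one_iff.1 h0).le)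
      exact hy (funext fun j => sub_eq_zero.1 (Int.natAbs_eq_zero.1 (hzero j)))
    -- each neighbour: `ρ^{n(y ± e_μ)} ≤ ρ^{n y − 1}`
    have hnb : ∀ (μ : Fin d) (σ : ℤ), σ = 1 ∨ σ = -1 → ρ ^ n (y + σ • unitVec μ) ≤ ρ ^ (n y - 1) := fun μ σ hσ =>
      pow_le_pow_of_le_one hρ0 hρ1 (l1_sub_one_le_step y c μ hσ)
    have hprof : ∑ μ : Fin d, (ρ ^ n (y + unitVec μ) + ρ ^ n (y - unitVec μ)) ≤ (2 * d + α ^ 2) * ρ ^ n y := by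
      calc ∑ μ : Fin d, (ρ ^ n (y + unitVec μ) + ρ ^ n (y - unitVec μ)) ≤ ∑ _μ : Fin d, (ρ ^ (n y - 1) + ρ ^ (n y - 1)) := by
            refine Finset.sum_le_sum fun μ _ => add_le_add ?_ ?_
            · simpa using hnb μ 1 (Or.inl rfl)
            · have := hnb μ (-1) (Or.inr rfl)
              simpa [sub_eq_add_neg] using this
        _ = 2 * d * ρ ^ (n y - 1) := by
            rw [Finset.sum_const, Finset.card_univ, Fintype.card_fin, nsmul_eq_mul]
            ring
        _ = (2 * d + α ^ 2) * ρ ^ n y := by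
            obtain ⟨m, hm⟩ := Nat.exists_eq_add_of_le hn1
            rw [hm, Nat.add_sub_cancel_left, pow_add, pow_one]
            calc 2 * (d : ℝ) * ρ ^ m = ((2 * d + α ^ 2) * ρ) * ρ ^ m := by rw [hρkey]
              _ = (2 * d + α ^ 2) * (ρ * ρ ^ m) := by ring
    have hsum : ∑ μ : Fin d, (w (y + unitVec μ) + w (y - unitVec μ)) =
        ∑ μ : Fin d, (K (y + unitVec μ) c + K (y - unitVec μ) c) -
          K 0 0 * ∑ μ : Fin d, (ρ ^ n (y + unitVec μ) + ρ ^ n (y - unitVec μ)) := by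
      simp only [hw, Finset.mul_sum, ← Finset.sum_sub_distrib]
      refine Finset.sum_congr rfl fun μ _ => ?_
      ring
    rw [hsum]
    simp only [hw]
    nlinarith [mul_le_mul_of_nonneg_left hprof hK00]
  have := le_of_subsolution' (κ := α ^ 2) hα2 {c} hB hΓ hsub x
  simp only [hw] at this
  linarith

/-- **(C.4)-type domination by the diagonal**: `C_{ΔΔ′} ≦ C_{ΔΔ} = E z_Δ²` (print: `0 ≦ C_{ΔΔ′} < ½` at the normalisation
`E z_Δ² = ½`; the strict inequality is not claimed). [cite: BenfattoEtAl1978, Appendix C (C.4) p.164] -/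
theorem freeCov_le_diag {α β : ℝ} (hα : 0 < α) (hβ : 0 < β) (x y : B1Eq324BenfattoLemma.Site d) :
    freeCov d α β x y ≤ freeCov d α β 0 0 := by
  refine (freeCov_le_self_mul_pow_l1 hα hβ x y).trans ?_
  have hρ0 : (0 : ℝ) ≤ 2 * d / (2 * d + α ^ 2) := by positivity
  have hρ1 : 2 * d / (2 * d + α ^ 2) ≤ (1 : ℝ) := by
    rw [div_le_one (by positivity)]
    nlinarith
  exact mul_le_of_le_one_right (freeCov_nonneg hα hβ 0 0) (pow_le_one₀ hρ0 hρ1)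

/-- `cubeDist ≤ ℓ¹`: the Euclidean distance of the unit cubes is at most the `ℓ¹` distance of their corners
(`√(Σ gⱼ²) ≤ Σ gⱼ ≤ Σ |xⱼ − yⱼ|` for the non-negative gaps `gⱼ = max(|xⱼ − yⱼ| − 1, 0)`). [folklore] -/
private theorem cubeDist_le_l1 (x y : B1Eq324BenfattoLemma.Site d) :
    cubeDist x y ≤ ((∑ j, (x j - y j).natAbs : ℕ) : ℝ) := by
  have hg0 : ∀ j, 0 ≤ max (|((x j : ℝ) - (y j : ℝ))| - 1) 0 := fun j => le_max_right _ _
  have hgle : ∀ j, max (|((x j : ℝ) - (y j : ℝ))| - 1) 0 ≤ ((x j - y j).natAbs : ℝ) := by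
    intro j
    have habs : |((x j : ℝ) - (y j : ℝ))| = ((x j - y j).natAbs : ℝ) := by
      rw [← Int.cast_sub, ← Int.cast_natCast, Int.natCast_natAbs, Int.cast_abs]
    rw [habs]
    exact max_le (by linarith) (by positivity)
  unfold cubeDist
  rw [Real.sqrt_le_left (by positivity)]
  push_cast
  calc ∑ j, max (|((x j : ℝ) - (y j : ℝ))| - 1) 0 ^ 2 ≤ ∑ j, max (|((x j : ℝ) - (y j : ℝ))| - 1) 0 * ((x j - y j).natAbs : ℝ) :=
        Finset.sum_le_sum fun j _ => by rw [sq]; exact mul_le_mul_of_nonneg_left (hgle j) (hg0 j)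
    _ ≤ (∑ j, ((x j - y j).natAbs : ℝ)) ^ 2 := by
        rw [sq, Finset.sum_mul]
        refine Finset.sum_le_sum fun j _ => ?_
        calc max (|((x j : ℝ) - (y j : ℝ))| - 1) 0 * ((x j - y j).natAbs : ℝ)
            ≤ ((x j - y j).natAbs : ℝ) * ((x j - y j).natAbs : ℝ) :=
              mul_le_mul_of_nonneg_right (hgle j) (by positivity)
          _ ≤ ((x j - y j).natAbs : ℝ) * ∑ i, ((x i - y i).natAbs : ℝ) :=
              mul_le_mul_of_nonneg_left
                (Finset.single_le_sum (f := fun i => ((x i - y i).natAbs : ℝ)) (fun i _ => by positivity)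
                  (Finset.mem_univ j)) (by positivity)

/-- **(C.2) AS PRINTED** (for `d ≥ 1`): `C_{ΔΔ′} ≦ (1/(βα²))·(1 + α²/(2d))^{−d(Δ,Δ′)}` with `d(Δ,Δ′)` the cube distance of p. 146
(`K(0,0) ≤ 1/(βα²)`, `ρ = (1 + α²/2d)⁻¹`, `ρ^{|x−y|₁} ≤ ρ^{d(Δ,Δ′)}`). [cite: BenfattoEtAl1978, Appendix C (C.2) p.164] -/
theorem freeCov_le_decay {α β : ℝ} (hα : 0 < α) (hβ : 0 < β) (hd : 0 < d) (x y : B1Eq324BenfattoLemma.Site d) :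
    freeCov d α β x y ≤ 1 / (β * α ^ 2) * (1 + α ^ 2 / (2 * d)) ^ (-(cubeDist x y)) := by
  have hd' : (0 : ℝ) < 2 * d := by positivity
  set a : ℝ := 1 + α ^ 2 / (2 * d) with ha
  have ha1 : 1 ≤ a := by
    rw [ha]
    have : 0 ≤ α ^ 2 / (2 * d) := by positivity
    linarith
  have ha0 : 0 < a := by linarith
  have hρa : 2 * d / (2 * d + α ^ 2) = a⁻¹ := by
    rw [ha]
    field_simp
  have h1 := freeCov_le_self_mul_pow_l1 hα hβ x y
  rw [hρa, inv_pow, ← Real.rpow_natCast, ← Real.rpow_neg ha0.le] at h1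
  have hK00 : freeCov d α β 0 0 ≤ 1 / (β * α ^ 2) := by
    have := (abs_le.1 (abs_freeCov_le hα hβ (0 : B1Eq324BenfattoLemma.Site d) 0)).2
    rw [one_div, mul_inv]
    exact this
  have hexp : a ^ (-(((∑ j, (x j - y j).natAbs : ℕ) : ℝ))) ≤ a ^ (-(cubeDist x y)) :=
    Real.rpow_le_rpow_of_exponent_le ha1 (neg_le_neg (cubeDist_le_l1 x y))
  calc freeCov d α β x y ≤ freeCov d α β 0 0 * a ^ (-(((∑ j, (x j - y j).natAbs : ℕ) : ℝ))) := h1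
    _ ≤ 1 / (β * α ^ 2) * a ^ (-(cubeDist x y)) :=
        mul_le_mul hK00 hexp (Real.rpow_nonneg ha0.le _) (by positivity)

/-! ## (C.5): the total mass -/

/-- `Δ′ ↦ C_{ΔΔ′}` is summable. [cite: BenfattoEtAl1978, Appendix C (C.5) p.164] -/
theorem summable_freeCov {α β : ℝ} (hα : 0 < α) (x : B1Eq324BenfattoLemma.Site d) :
    Summable fun y => freeCov d α β x y := by
  have hsq : Real.sqrt (α ^ 2) = α := Real.sqrt_sq hα.le
  have hfun : (fun y => freeCov d α β x y) = fun y => (β⁻¹ * (α ^ d / α ^ 2)) * Cxi d α ((Equiv.subLeft x) y) := by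
    funext y
    simp only [freeCov, CetaM, hsq, one_mul, Equiv.subLeft_apply]
    ring
  rw [hfun]
  exact ((summable_Cxi (d := d) hα).comp_injective (Equiv.subLeft x).injective).mul_left _

/-- **(C.5) — the total mass of the free covariance**: `‖C‖ ≡ Σ_{Δ′} C_{ΔΔ′} = 1/(α²β)` (r15's unit mass `Σ_y ξ^dC^ξ(y) = 1`
for `C¹_{α²} = α^{d−2}C^{α}`). [cite: BenfattoEtAl1978, Appendix C (C.5) p.164] -/
theorem tsum_freeCov {α β : ℝ} (hα : 0 < α) (x : B1Eq324BenfattoLemma.Site d) :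
    ∑' y, freeCov d α β x y = 1 / (α ^ 2 * β) := by
  have hsq : Real.sqrt (α ^ 2) = α := Real.sqrt_sq hα.le
  have hα0 : α ≠ 0 := hα.ne'
  have hfun : (fun y => freeCov d α β x y) = fun y => (β⁻¹ * (α ^ 2)⁻¹) * (α ^ d * Cxi d α ((Equiv.subLeft x) y)) := by
    funext y
    simp only [freeCov, CetaM, hsq, one_mul, Equiv.subLeft_apply]
    field_simp
  rw [hfun, tsum_mul_left, Equiv.tsum_eq (Equiv.subLeft x) (fun z => α ^ d * Cxi d α z), tsum_Cxi hα]
  field_simp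

/-! ## Positive DEFINITENESS of the free covariance on distinct tesserae -/

/-- The Fourier weight of the free covariance is STRICTLY positive. [cite: BenfattoEtAl1978, Appendix C (C.2) p.164] -/
private theorem weightF_pos {α : ℝ} (hα : 0 < α) (p : Fin d → ℝ) : 0 < B3WTFreeMeasure.weightF d 1 (α ^ 2) p := by
  unfold B3WTFreeMeasure.weightF
  have := lapSymbol_nonneg d 1 p
  positivity

/-- **Gram representation of the free quadratic form on a finite set of tesserae**:
`Σ_{s,t∈Γ} v_s v_t K(s,t) = β⁻¹ ∫_{|p_μ|≤π} w(p) Σ_b (Σ_s v_s φ_b(s,p))² dp`, `φ_b` the cos / sin modes, `w` the weight of (C.2)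
(the momentum integral of (C.2), `B3WTFreeMeasure.CetaM_sub_eq_integral`). [cite: BenfattoEtAl1978, Appendix C (C.2) p.164] -/
private theorem sum_sum_freeCov_eq_integral {α β : ℝ} (hα : 0 < α) (Γ : Finset (B1Eq324BenfattoLemma.Site d))
    (v : Γ → ℝ) :
    ∑ s : Γ, ∑ t : Γ, v s * v t * freeCov d α β s t =
      β⁻¹ * ∫ p in bzBox d 1, B3WTFreeMeasure.weightF d 1 (α ^ 2) p *
        ∑ b : Bool, (∑ s : Γ, v s * B3WTFreeMeasure.mode 1 b (s : B1Eq324BenfattoLemma.Site d) p) ^ 2 := by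
  have hM : (0 : ℝ) < α ^ 2 := pow_pos hα 2
  set w := B3WTFreeMeasure.weightF d 1 (α ^ 2) with hw
  set φ : Bool → B1Eq324BenfattoLemma.Site d → (Fin d → ℝ) → ℝ := fun b z p => B3WTFreeMeasure.mode 1 b z p with hφ
  set μ := (volume : Measure (Fin d → ℝ)).restrict (bzBox d 1) with hμ
  have hint : ∀ (b : Bool) (z z' : B1Eq324BenfattoLemma.Site d), Integrable (fun p => w p * (φ b z p * φ b z' p)) μ :=
    fun b z z' => B3WTFreeMeasure.integrable_weightF_mul_mode hM b z z'
  have hI : ∀ s t : Γ, Integrable (fun p => v s * v t * (w p * ∑ b, φ b s p * φ b t p)) μ := by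
    intro s t
    refine Integrable.const_mul ?_ _
    have : (fun p => w p * ∑ b, φ b s p * φ b t p) = fun p => ∑ b, w p * (φ b s p * φ b t p) :=
      funext fun p => by rw [Finset.mul_sum]
    rw [this]
    exact integrable_finsetSum _ fun b _ => hint b s t
  have hK : ∀ s t : Γ, freeCov d α β s t = β⁻¹ * ∫ p, w p * ∑ b, φ b s p * φ b t p ∂μ := by
    intro s t
    simp only [freeCov, hμ, hw, hφ]
    rw [B3WTFreeMeasure.CetaM_sub_eq_integral one_pos hM]
  calc ∑ s : Γ, ∑ t : Γ, v s * v t * freeCov d α β s t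
      = β⁻¹ * ∑ s : Γ, ∑ t : Γ, ∫ p, v s * v t * (w p * ∑ b, φ b s p * φ b t p) ∂μ := by
        rw [Finset.mul_sum]
        refine Finset.sum_congr rfl fun s _ => ?_
        rw [Finset.mul_sum]
        refine Finset.sum_congr rfl fun t _ => ?_
        rw [hK, integral_const_mul]
        ring
    _ = β⁻¹ * ∫ p, ∑ s : Γ, ∑ t : Γ, v s * v t * (w p * ∑ b, φ b s p * φ b t p) ∂μ := by
        congr 1
        rw [integral_finsetSum _ fun s _ => integrable_finsetSum _ fun t _ => hI s t]
        exact Finset.sum_congr rfl fun s _ => (integral_finsetSum _ fun t _ => hI s t).symm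
    _ = β⁻¹ * ∫ p, w p * ∑ b, (∑ s : Γ, v s * φ b s p) ^ 2 ∂μ := by
        congr 1
        refine integral_congr_ae (ae_of_all _ fun p => ?_)
        symm
        calc w p * ∑ b, (∑ s : Γ, v s * φ b s p) ^ 2
            = w p * ∑ b, ∑ s : Γ, ∑ t : Γ, v s * φ b s p * (v t * φ b t p) := by
              congr 1
              refine Finset.sum_congr rfl fun b _ => ?_
              rw [sq, Finset.sum_mul_sum]
          _ = ∑ s : Γ, ∑ t : Γ, w p * ∑ b, v s * φ b s p * (v t * φ b t p) := by
              rw [Finset.sum_comm, Finset.mul_sum]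
              refine Finset.sum_congr rfl fun s _ => ?_
              rw [Finset.sum_comm, Finset.mul_sum]
          _ = ∑ s : Γ, ∑ t : Γ, v s * v t * (w p * ∑ b, φ b s p * φ b t p) := by
              refine Finset.sum_congr rfl fun s _ => Finset.sum_congr rfl fun t _ => ?_
              simp only [Finset.mul_sum]
              refine Finset.sum_congr rfl fun b _ => ?_
              ring

/-- **THE FREE COVARIANCE IS POSITIVE DEFINITE ON EVERY FINITE SET OF TESSERAE**: the Gram matrix
`K_ΓΓ = covGram (freeCov d α β) Γ` is positive definite (`α, β > 0`) — the weight of the momentum integral (C.2) is strictly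
positive and the characters `e^{ip·ξ_Δ}`, `Δ ∈ Γ`, are orthogonal on the Brillouin box (`B3CxiPropagator.integral_bzBox_cos_phase`),
so a vanishing quadratic form forces every coefficient to vanish.  Consequently `K_ΓΓ` is invertible and the regression
dictionary of `B1Eq324BenfattoLemma` (`condMean`, `condCov`, `condField`) is print's (C.7) conditioning EXACTLY (never Mathlib's
singular-inverse branch). [cite: BenfattoEtAl1978, Appendix C (C.2) p.164] -/
theorem posDef_covGram_freeCov {α β : ℝ} (hα : 0 < α) (hβ : 0 < β) (Γ : Finset (B1Eq324BenfattoLemma.Site d)) :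
    (covGram (freeCov d α β) Γ).PosDef := by
  have hM : (0 : ℝ) < α ^ 2 := pow_pos hα 2
  refine Matrix.PosDef.of_dotProduct_mulVec_pos (isPosSemidefKernel_freeCov hα hβ Γ).isHermitian fun v hv => ?_
  rw [star_trivial]
  -- the quadratic form
  have hQ : v ⬝ᵥ (covGram (freeCov d α β) Γ *ᵥ v) = ∑ s : Γ, ∑ t : Γ, v s * v t * freeCov d α β s t := by
    simp only [dotProduct, Matrix.mulVec, covGram_apply, Finset.mul_sum]
    refine Finset.sum_congr rfl fun s _ => Finset.sum_congr rfl fun t _ => ?_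
    ring
  rw [hQ]
  have hnn : 0 ≤ ∑ s : Γ, ∑ t : Γ, v s * v t * freeCov d α β s t := by
    have h := (isPosSemidefKernel_freeCov hα hβ Γ).dotProduct_mulVec_nonneg v
    rw [star_trivial, hQ] at h
    exact h
  refine lt_of_le_of_ne hnn fun h0 => hv ?_
  -- `Q(v) = 0` forces `v = 0`
  set w := B3WTFreeMeasure.weightF d 1 (α ^ 2) with hw
  set μ := (volume : Measure (Fin d → ℝ)).restrict (bzBox d 1) with hμ
  set F : Bool → (Fin d → ℝ) → ℝ := fun b p =>
    ∑ s : Γ, v s * B3WTFreeMeasure.mode 1 b (s : B1Eq324BenfattoLemma.Site d) p with hF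
  have hrep := sum_sum_freeCov_eq_integral (d := d) (β := β) hα Γ v
  rw [← h0] at hrep
  have hint0 : ∫ p, w p * ∑ b, F b p ^ 2 ∂μ = 0 := by
    have := hrep.symm
    rwa [mul_eq_zero, or_iff_right (inv_ne_zero hβ.ne')] at this
  -- continuity ⇒ integrability of the pieces on the compact box
  have hcpt : IsCompact (bzBox d 1) := by rw [B3CxiTadpoleLimit.bzBox_one_eq_Icc]; exact isCompact_Icc
  have hFc : ∀ b, Continuous (F b) := fun b =>
    continuous_finsetSum _ fun s _ => continuous_const.mul (B3WTFreeMeasure.continuous_mode 1 b _)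
  have hgc : Continuous fun p => w p * ∑ b, F b p ^ 2 :=
    (B3WTFreeMeasure.continuous_weightF hM).mul (continuous_finsetSum _ fun b _ => (hFc b).pow 2)
  have hgint : Integrable (fun p => w p * ∑ b, F b p ^ 2) μ := hgc.continuousOn.integrableOn_compact hcpt
  have hg0 : ∀ p, 0 ≤ w p * ∑ b, F b p ^ 2 := fun p =>
    mul_nonneg (B3WTFreeMeasure.weightF_nonneg hM p) (Finset.sum_nonneg fun b _ => sq_nonneg _)
  have hae : (fun p => w p * ∑ b, F b p ^ 2) =ᵐ[μ] 0 :=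
    (integral_eq_zero_iff_of_nonneg (fun p => hg0 p) hgint).1 hint0
  -- hence each mode sum vanishes a.e. on the box
  have hFae : ∀ b, (fun p => F b p) =ᵐ[μ] 0 := by
    intro b
    filter_upwards [hae] with p hp
    have hwp : 0 < w p := weightF_pos hα p
    have hsum : ∑ b', F b' p ^ 2 = 0 := by
      simpa [hwp.ne'] using hp
    have := (Finset.sum_eq_zero_iff_of_nonneg fun b' _ => sq_nonneg (F b' p)).1 hsum b (Finset.mem_univ b)
    exact pow_eq_zero_iff (two_ne_zero) |>.1 this
  -- extract the coefficient of the tessera `k` by orthogonality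
  funext k
  have hmodeint : ∀ (b : Bool) (s : Γ), Integrable (fun p => B3WTFreeMeasure.mode 1 b (s : B1Eq324BenfattoLemma.Site d) p *
      B3WTFreeMeasure.mode 1 b (k : B1Eq324BenfattoLemma.Site d) p) μ := fun b s =>
    ((B3WTFreeMeasure.continuous_mode 1 b _).mul (B3WTFreeMeasure.continuous_mode 1 b _)).continuousOn.integrableOn_compact hcpt
  -- `I_k = ∫ Σ_b F_b(p) φ_b(k,p) = 0`
  have hIzero : ∫ p, ∑ b, F b p * B3WTFreeMeasure.mode 1 b (k : B1Eq324BenfattoLemma.Site d) p ∂μ = 0 := by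
    refine integral_eq_zero_of_ae ?_
    have h1 := hFae true
    have h2 := hFae false
    filter_upwards [h1, h2] with p hp1 hp2
    simp only [Pi.zero_apply] at hp1 hp2 ⊢
    rw [Fintype.sum_bool, hp1, hp2]
    ring
  -- `I_k = Σ_s v_s ∫ cos(p·(s − k)) = (2π)^d v_k`
  have hIval : ∫ p, ∑ b, F b p * B3WTFreeMeasure.mode 1 b (k : B1Eq324BenfattoLemma.Site d) p ∂μ =
      (2 * Real.pi) ^ d * v k := by
    have hexp : (fun p => ∑ b, F b p * B3WTFreeMeasure.mode 1 b (k : B1Eq324BenfattoLemma.Site d) p) =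
        fun p => ∑ s : Γ, v s * ∑ b, B3WTFreeMeasure.mode 1 b (s : B1Eq324BenfattoLemma.Site d) p *
          B3WTFreeMeasure.mode 1 b (k : B1Eq324BenfattoLemma.Site d) p := by
      funext p
      simp only [hF, Finset.sum_mul, Finset.mul_sum]
      rw [Finset.sum_comm]
      refine Finset.sum_congr rfl fun s _ => Finset.sum_congr rfl fun b _ => ?_
      ring
    rw [hexp, integral_finsetSum _ fun s _ => ?_]
    · have hterm : ∀ s : Γ, ∫ p, v s * ∑ b, B3WTFreeMeasure.mode 1 b (s : B1Eq324BenfattoLemma.Site d) p *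
          B3WTFreeMeasure.mode 1 b (k : B1Eq324BenfattoLemma.Site d) p ∂μ =
          v s * (if (s : B1Eq324BenfattoLemma.Site d) - k = 0 then (2 * Real.pi / 1) ^ d else 0) := by
        intro s
        rw [integral_const_mul]
        congr 1
        simp only [B3WTFreeMeasure.sum_mode_mul, hμ]
        exact integral_bzBox_cos_phase one_pos _
      simp only [hterm, div_one]
      rw [Finset.sum_eq_single k]
      · simp [mul_comm]
      · intro s _ hs
        have : (s : B1Eq324BenfattoLemma.Site d) - k ≠ 0 := fun h => hs (Subtype.ext (sub_eq_zero.1 h))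
        simp [this]
      · intro h
        exact absurd (Finset.mem_univ k) h
    · refine Integrable.const_mul ?_ _
      exact integrable_finsetSum _ fun b _ => hmodeint b s
  rw [hIzero] at hIval
  have hpi : (2 * Real.pi) ^ d ≠ 0 := pow_ne_zero d (by positivity)
  have : v k = 0 := by
    have := hIval.symm
    rwa [mul_eq_zero, or_iff_right hpi] at this
  simpa using this

/-- **`K_ΓΓ` is invertible** (`IsUnit` determinant), so the singular-inverse branch of the tree's regression formulae never
occurs for the free field. [cite: BenfattoEtAl1978, Appendix C (C.2) p.164] -/
theorem isUnit_det_covGram_freeCov {α β : ℝ} (hα : 0 < α) (hβ : 0 < β) (Γ : Finset (B1Eq324BenfattoLemma.Site d)) :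
    IsUnit (covGram (freeCov d α β) Γ).det :=
  (Matrix.isUnit_iff_isUnit_det _).1 (posDef_covGram_freeCov hα hβ Γ).isUnit

/-! ## (C.6) entrywise: `0 ≦ C^Γ_{ΔΔ′} ≦ C_{ΔΔ′}` -/

/-- The conditional covariance is the free covariance minus the regression of the column `K(·, y)`:
`C^Γ(x, y) = K(x, y) − u^{(y)}(x)`, `u^{(y)} = condMean K Γ (K(·, y))`. [cite: BenfattoEtAl1978, Appendix C (C.6)–(C.7) p.164] -/
theorem condCov_eq_sub_condMean (G : B1Eq324BenfattoLemma.Site d → B1Eq324BenfattoLemma.Site d → ℝ)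
    (Γ : Finset (B1Eq324BenfattoLemma.Site d)) (x y : B1Eq324BenfattoLemma.Site d) :
    condCov G Γ x y = G x y - condMean G Γ (fun c => G c y) x := rfl

/-- The regression of a column of the free covariance is bounded in `x`. [folklore] -/
private theorem abs_condMean_col_le {α β : ℝ} (hα : 0 < α) (hβ : 0 < β) (Γ : Finset (B1Eq324BenfattoLemma.Site d))
    (zbar : B1Eq324BenfattoLemma.Site d → ℝ) (x : B1Eq324BenfattoLemma.Site d) :
    |condMean (freeCov d α β) Γ zbar x| ≤
      β⁻¹ * (α ^ 2)⁻¹ * ∑ c : Γ, |((covGram (freeCov d α β) Γ)⁻¹ *ᵥ fun c' : Γ => zbar c') c| := by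
  rw [condMean_eq_sum_mul, Finset.mul_sum]
  refine (Finset.abs_sum_le_sum_abs _ _).trans (Finset.sum_le_sum fun c _ => ?_)
  rw [abs_mul]
  exact mul_le_mul_of_nonneg_right (abs_freeCov_le hα hβ x c) (abs_nonneg _)

/-- **(C.6) AS PRINTED, entrywise**: `0 ≦ C^Γ_{ΔΔ′} ≦ C_{ΔΔ′}` for the conditioned free field — both inequalities by the massive
maximum principle: the regression `u^{(y)}` of the non-negative column `K(·, y)` is massive-harmonic off `Γ`, equals `K(·, y) ≥ 0`
on `Γ` (so `u^{(y)} ≥ 0`, the upper bound), and `u^{(y)} − K(·, y)` vanishes on `Γ` and is a subsolution off `Γ` (the lattice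
equation contributes `−β⁻¹δ_{xy} ≤ 0`; so `u^{(y)} ≤ K(·, y)`, the lower bound).  The Gram matrix is invertible
(`isUnit_det_covGram_freeCov`), so this is print's `C^Γ` exactly. [cite: BenfattoEtAl1978, Appendix C (C.6) p.164] -/
theorem condCov_freeCov_nonneg_le {α β : ℝ} (hα : 0 < α) (hβ : 0 < β) (Γ : Finset (B1Eq324BenfattoLemma.Site d))
    (x y : B1Eq324BenfattoLemma.Site d) :
    0 ≤ condCov (freeCov d α β) Γ x y ∧ condCov (freeCov d α β) Γ x y ≤ freeCov d α β x y := by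
  have hα2 : 0 < α ^ 2 := by positivity
  set K := freeCov d α β with hK
  have hdet := isUnit_det_covGram_freeCov (d := d) hα hβ Γ
  set u : B1Eq324BenfattoLemma.Site d → ℝ := condMean K Γ (fun c => K c y) with hu
  obtain ⟨B₀, hB₀⟩ : ∃ B₀, ∀ z, |u z| ≤ B₀ := ⟨_, fun z => abs_condMean_col_le hα hβ Γ (fun c => K c y) z⟩
  have hharm : ∀ z ∉ Γ, (2 * d + α ^ 2) * u z = ∑ μ : Fin d, (u (z + unitVec μ) + u (z - unitVec μ)) :=
    fun z hz => condMean_freeCov_harmonic β hα Γ (fun c => K c y) hz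
  have hΓval : ∀ c ∈ Γ, u c = K c y := fun c hc => condMean_apply_of_mem K Γ (fun c => K c y) hdet hc
  have hKB : ∀ z, |K z y| ≤ β⁻¹ * (α ^ 2)⁻¹ := fun z => abs_freeCov_le hα hβ z y
  -- upper bound: `u ≥ 0`
  have hup : ∀ z, -u z ≤ 0 := by
    refine le_of_subsolution' (κ := α ^ 2) (B := B₀) hα2 Γ (fun z => ?_) (fun c hc => ?_) (fun z hz => ?_)
    · linarith [(abs_le.1 (hB₀ z)).1]
    · rw [hΓval c hc]
      linarith [freeCov_nonneg hα hβ (c : B1Eq324BenfattoLemma.Site d) y]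
    · rw [mul_neg, hharm z hz, ← Finset.sum_neg_distrib]
      refine le_of_eq (Finset.sum_congr rfl fun μ _ => ?_)
      ring
  -- lower bound: `u ≤ K(·, y)`
  have hlow : ∀ z, u z - K z y ≤ 0 := by
    refine le_of_subsolution' (κ := α ^ 2) (B := B₀ + β⁻¹ * (α ^ 2)⁻¹) hα2 Γ (fun z => ?_) (fun c hc => ?_)
      (fun z hz => ?_)
    · linarith [(abs_le.1 (hB₀ z)).2, (abs_le.1 (hKB z)).1]
    · rw [hΓval c hc, sub_self]
    · have h1 := hharm z hz
      have h2 := freeCov_lattice_eq (d := d) β hα z y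
      have hδ : 0 ≤ (if z = y then β⁻¹ else (0 : ℝ)) := by
        split_ifs
        · exact (inv_pos.2 hβ).le
        · exact le_rfl
      have : ∑ μ : Fin d, ((u (z + unitVec μ) - K (z + unitVec μ) y) + (u (z - unitVec μ) - K (z - unitVec μ) y)) =
          ∑ μ : Fin d, (u (z + unitVec μ) + u (z - unitVec μ)) -
            ∑ μ : Fin d, (K (z + unitVec μ) y + K (z - unitVec μ) y) := by
        rw [← Finset.sum_sub_distrib]
        refine Finset.sum_congr rfl fun μ _ => ?_
        ring
      rw [this, ← hK] at *
      rw [hK] at h2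
      rw [← hK] at h2
      nlinarith [h1, h2, hδ]
  constructor
  · rw [condCov_eq_sub_condMean]
    linarith [hlow x]
  · rw [condCov_eq_sub_condMean]
    linarith [hup x]

end Literature.MathematicalPhysics.QuantumFieldTheory.Balaban1983to89.B1Eq324BenfattoAppendixC2

end
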